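import Literature.RepresentationTheory.TwistedCoinvariants
import HarnessLib

/-!
# Twisted coinvariants: composing two transports through a common model, with a scalar twist

Topic `RepresentationTheory`; namespace `Literature.RepresentationTheory.TwistedCoinv` (sequel of `TwistedCoinvariants`).  KERNEL ONLY: theorems; no definition,
no named fact, no `sorry`.  Cell `hodgecm-mathlib` (D-0151), programme P5 (crux HLiu418 = stmt-HodgeConjecture-24832), piece **(C4)-core (generic)** of the
road card `F0/P5/A-p18/g23/ROAD-L4if-v3.A-p18g23.md` §6 (A-p18 (g23), 2026-08-31).

The situation of the in-house road for [Liu2021, Lem. D.1 (4)] «if»: one model representation `ρ₁` of `G` (the theta representation `ω ∘ s_λ^{T}`), two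
other representations `ρ_b`, `ρ_k` whose `χ_b`- resp. `χ`-coinvariants under the centre `ι : H →* G` are identified with those of `ρ₁` ALONG two maps
`κ_b, κ_k : G → G` (`e₁ ∘ rep(g) = rep(κ_b g) ∘ e₁`, ★ `exists_coinv_equiv_localPiGalConj`; `e₃ ∘ rep(g) = rep(κ_k g) ∘ e₃`, ★ `exists_coinv_equiv_localCongr_k`),
and a pointwise comparison `rep(κ_b g) = c(g) • rep(κ_k g)` on the model (the central determinant twist of ★ `localPiGalConj_eq_localCenter_mul_localCongr`).
* **`exists_equiv_of_two_transports`**: then `E := e₃⁻¹ ∘ e₁ : (ρ_b)_{H,χ_b} ≃ (ρ_k)_{H,χ}` satisfies `E ∘ rep(g) = c(g) • rep(g) ∘ E` — in the road's words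
  **`Θ_{ξ∘bar₁}(λᶜ, −a) ≅ (ξ ∘ det⁻¹) ⊗ Θ_ξ(λ, m₀a)`** once instantiated.  Pure linear algebra.
Nothing of the cited sources is asserted; HC_CM is proved only modulo the printed citations until rung 0 closes.

## References
* [GelbartRogawski1991] S. Gelbart, J. Rogawski, Invent. Math. 105 (1991), §3.1 Remark p. 457 L4–13.
* [MoeglinVignerasWaldspurger1987] LNM 1291 (1987), Chap. 2 II.2; Chap. 3 IV.
* [Liu2021] Y. Liu, App. D §D.1 Step 3 (l. 5221), Lemma D.1 (4) (l. 5235).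
-/

set_option autoImplicit false

noncomputable section

namespace Literature.RepresentationTheory.TwistedCoinv

variable {k : Type*} [CommRing k] {G H S : Type*} [Group G] [Group H] [AddCommGroup S] [Module k S]

/-- **Composing two transports through a common model, with a scalar twist.**  `E := e₃⁻¹ ∘ e₁` satisfies `E ∘ rep_b(g) = c(g) • rep_k(g) ∘ E`.
[cite: GelbartRogawski1991, §3.1 Remark p. 457 L4–13] [cite: Liu2021, App. D §D.1 Step 3 (l. 5221)] -/
theorem exists_equiv_of_two_transports (ρ₁ ρb ρk : Representation k G S) (ι : H →* G) (χ χb : H →* kˣ) (κb κk : G → G) (c : G → k)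
    (hc₁ : ∀ (g : G) (h : H), Commute (ρ₁ g) ((ρ₁.comp ι) h)) (hcb : ∀ (g : G) (h : H), Commute (ρb g) ((ρb.comp ι) h))
    (hck : ∀ (g : G) (h : H), Commute (ρk g) ((ρk.comp ι) h))
    (e₁ : Coinv (ρb.comp ι) χb ≃ₗ[k] Coinv (ρ₁.comp ι) χ) (he₁ : ∀ (g : G) (x : Coinv (ρb.comp ι) χb), e₁ (rep χb ρb hcb g x) = rep χ ρ₁ hc₁ (κb g) (e₁ x))
    (e₃ : Coinv (ρk.comp ι) χ ≃ₗ[k] Coinv (ρ₁.comp ι) χ) (he₃ : ∀ (g : G) (x : Coinv (ρk.comp ι) χ), e₃ (rep χ ρk hck g x) = rep χ ρ₁ hc₁ (κk g) (e₃ x))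
    (h2 : ∀ (g : G) (y : Coinv (ρ₁.comp ι) χ), rep χ ρ₁ hc₁ (κb g) y = c g • rep χ ρ₁ hc₁ (κk g) y) :
    ∃ E : Coinv (ρb.comp ι) χb ≃ₗ[k] Coinv (ρk.comp ι) χ, ∀ (g : G) (x : Coinv (ρb.comp ι) χb), E (rep χb ρb hcb g x) = c g • rep χ ρk hck g (E x) := by
  refine ⟨e₁.trans e₃.symm, fun g x => ?_⟩
  rw [LinearEquiv.trans_apply, LinearEquiv.trans_apply, he₁, h2, map_smul]
  congr 1
  rw [LinearEquiv.symm_apply_eq, he₃, LinearEquiv.apply_symm_apply]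

/-- the same, read as an isomorphism in the other direction: `E′ := e₁⁻¹ ∘ e₃ : (ρ_k)_{H,χ} ≃ (ρ_b)_{H,χ_b}` with `c(g) • E′ ∘ rep_k(g) = rep_b(g) ∘ E′`.
[cite: GelbartRogawski1991, §3.1 Remark p. 457 L4–13] [cite: Liu2021, App. D §D.1 Step 3 (l. 5221)] -/
theorem exists_equiv_of_two_transports' (ρ₁ ρb ρk : Representation k G S) (ι : H →* G) (χ χb : H →* kˣ) (κb κk : G → G) (c : G → k)
    (hc₁ : ∀ (g : G) (h : H), Commute (ρ₁ g) ((ρ₁.comp ι) h)) (hcb : ∀ (g : G) (h : H), Commute (ρb g) ((ρb.comp ι) h))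
    (hck : ∀ (g : G) (h : H), Commute (ρk g) ((ρk.comp ι) h))
    (e₁ : Coinv (ρb.comp ι) χb ≃ₗ[k] Coinv (ρ₁.comp ι) χ) (he₁ : ∀ (g : G) (x : Coinv (ρb.comp ι) χb), e₁ (rep χb ρb hcb g x) = rep χ ρ₁ hc₁ (κb g) (e₁ x))
    (e₃ : Coinv (ρk.comp ι) χ ≃ₗ[k] Coinv (ρ₁.comp ι) χ) (he₃ : ∀ (g : G) (x : Coinv (ρk.comp ι) χ), e₃ (rep χ ρk hck g x) = rep χ ρ₁ hc₁ (κk g) (e₃ x))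
    (h2 : ∀ (g : G) (y : Coinv (ρ₁.comp ι) χ), rep χ ρ₁ hc₁ (κb g) y = c g • rep χ ρ₁ hc₁ (κk g) y) :
    ∃ E' : Coinv (ρk.comp ι) χ ≃ₗ[k] Coinv (ρb.comp ι) χb, ∀ (g : G) (x : Coinv (ρk.comp ι) χ), c g • E' (rep χ ρk hck g x) = rep χb ρb hcb g (E' x) := by
  obtain ⟨E, hE⟩ := exists_equiv_of_two_transports ρ₁ ρb ρk ι χ χb κb κk c hc₁ hcb hck e₁ he₁ e₃ he₃ h2
  refine ⟨E.symm, fun g x => ?_⟩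
  apply E.injective
  rw [map_smul, hE, LinearEquiv.apply_symm_apply, LinearEquiv.apply_symm_apply]

/-- **∃-form** (the shape in which the transports are delivered): from `∃ e₁`, `∃ e₃` with the two equivariances and the pointwise comparison, `∃ E` with
`E ∘ rep_b(g) = c(g) • rep_k(g) ∘ E`.  (The destructuring happens here, in a small context.) [cite: GelbartRogawski1991, §3.1 Remark p. 457 L4–13]
[cite: Liu2021, App. D §D.1 Step 3 (l. 5221)] -/
theorem exists_equiv_of_two_transports_of_exists (ρ₁ ρb ρk : Representation k G S) (ι : H →* G) (χ χb : H →* kˣ) (κb κk : G → G) (c : G → k)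
    (hc₁ : ∀ (g : G) (h : H), Commute (ρ₁ g) ((ρ₁.comp ι) h)) (hcb : ∀ (g : G) (h : H), Commute (ρb g) ((ρb.comp ι) h))
    (hck : ∀ (g : G) (h : H), Commute (ρk g) ((ρk.comp ι) h))
    (h₁ : ∃ e₁ : Coinv (ρb.comp ι) χb ≃ₗ[k] Coinv (ρ₁.comp ι) χ, ∀ (g : G) (x : Coinv (ρb.comp ι) χb), e₁ (rep χb ρb hcb g x) = rep χ ρ₁ hc₁ (κb g) (e₁ x))
    (h₃ : ∃ e₃ : Coinv (ρk.comp ι) χ ≃ₗ[k] Coinv (ρ₁.comp ι) χ, ∀ (g : G) (x : Coinv (ρk.comp ι) χ), e₃ (rep χ ρk hck g x) = rep χ ρ₁ hc₁ (κk g) (e₃ x))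
    (h2 : ∀ (g : G) (y : Coinv (ρ₁.comp ι) χ), rep χ ρ₁ hc₁ (κb g) y = c g • rep χ ρ₁ hc₁ (κk g) y) :
    ∃ E : Coinv (ρb.comp ι) χb ≃ₗ[k] Coinv (ρk.comp ι) χ, ∀ (g : G) (x : Coinv (ρb.comp ι) χb), E (rep χb ρb hcb g x) = c g • rep χ ρk hck g (E x) := by
  obtain ⟨e₁, he₁⟩ := h₁
  obtain ⟨e₃, he₃⟩ := h₃
  exact exists_equiv_of_two_transports ρ₁ ρb ρk ι χ χb κb κk c hc₁ hcb hck e₁ he₁ e₃ he₃ h2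

end Literature.RepresentationTheory.TwistedCoinv

end
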